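import Summits.QuantumFields.BalabanUV.Beta.GAN24.ValueHessianLinearGauge
import Summits.QuantumFields.BalabanUV.Beta.WardLocusRecursive
import Summits.QuantumFields.BalabanUV.Beta.GAN24.ResolventLegCharges

/-!
# `BalabanUV.Beta.GAN24.LambdaSectorClassSlot` — binder row G-an2-4 ∕ (CONV-C), W-slot CT-W, conservation law (C)∕(C)sym AT ALL LEVELS, letter (Λ) of this lineage's note
# `HOME/b2b-balaban-gan24-formalise-leaf-04/g68/EXIT-FACE-CURRENT-TOWER.md` §7: **THE Λ SECTOR OF `SrecAt (j+1)` HAS NO WEIGHTED TWO-LEG CURRENT FOR CLASS SLOT DATA** — for every slot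
# datum `s(u) = c + (Φ(u_ν+1) − Φ(u_ν))` (bounded `Φ`) the slot contraction of the conversion coefficients `Σ'_u s(u)·lamCoeffK (KInvStep Lc j) (E2 d Lc j) Lc μ Y ν u` VANISHES (the
# value Hessian `E2_j` kills lattice gradients of linear-growth functions — leaf-06's `ValueHessianLinearGauge` — and `s = dφ`, `φ(x) = c·x_ν + Φ(x_ν)`), hence
# `Σ'_u s(u)·S^Λ ν u v q (inl κ′)(inl β) = 0` for every `v q κ′ β` and the Λ-sector hypothesis of `ExitFaceCurrentSectorSplit.divFree_current_SrecAt_succ_of_sectors` holds trivially.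

NOT IN PRINT; OUR BOOKKEEPING ([folklore] `tsum`∕Fubini bookkeeping BY NAME over leaf-06's `ValueHessianLinearGauge.tsum_E2_mul_grad_eq_zero_of_linGrowth`, node 7a's
`InterLevelTransport.SLam ∕ cwsum_apply`, `BalabanStepJetsSucc.lamCoeffK ∕ abs_lamCoeffK_le ∕ decays_E2 ∕ mmRead_inr_left`, an1's `AveragingHessianKernelsRooted.biLoc_hessFFAt`; G-an2-4
formalisation swarm, leaf prover `b2b-balaban-gan24-formalise-leaf-04`, gen 68).  HONEST FRAMING (cell contract, verbatim): «discharging `BetaPertH` makes Bałaban's UV stability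
UNCONDITIONAL — a real constructive-QFT result; it is NOT the continuum limit and NOT the Clay problem.»  HONEST DEPENDENCY (verbatim): «continuum YM on T⁴ ⇐ BetaPertH ∧ nine spine
estimates (0/9 proved); BetaPertH ⇐ (D1) ∧ (D4) ∧ CAP+tail; G-an2-4 gates asym, D1 and NE2/3/4.»

WHAT ([folklore]; generic `d`, `[NeZero Lc]`, in-block root, every `j`, bounded `Φ : ℤ → ℝ`; 0 `def`, 0 cited facts, 0 `def … : Prop`, 0 sorry): §1 `classPot_grad`, `abs_classPot_le`,
**`tsum_E2_mul_classSlot_eq_zero`** (`Σ'_y E2_j (x,y)_{inl κ, inl ν}·(c + dΦ(y_ν)) = 0`); §2 `summable_pair_lamCoeffK_classSlot`, **`tsum_classSlot_lamCoeffK_eq_zero`**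
(`Σ'_u (c + dΦ(u_ν))·lamCoeffK (KInvStep Lc j) (E2 d Lc j) Lc μ Y ν u = 0`); §3 **`tsum_classSlot_lamSector_eq_zero`** (`Σ'_u (c + dΦ(u_ν))·S^Λ_{j+1} ν u v q (inl κ′)(inl β) = 0`,
`S^Λ_{j+1} = SLam Lc (lamCoeffK (KInvStep Lc (j+1)) (E2 d Lc (j+1)) Lc) hessFFAt`) and **`divFree_lamSector_current`** (the Λ hypothesis of the sector split, for any leg weight `h`).
Level `0` (`lamCoeffOf (KInv Lc)`, an3's `elCol`) is NOT treated here.  Asserts NO value of Bałaban's tables; discharges NOTHING of (C)sym ∕ (Q-D) ∕ (Q-D-rate) ∕ «T2Shape» ∕ «T2Drift» ∕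
(hW, hWall); NEVER «G-an2-4 closed» as (CONV-C); NOT D1, NOT `BetaPertH`, NOT continuum, NOT Clay.  2026-08-23; no existing file touched.
-/

noncomputable section

open Finset
open scoped BigOperators
open Literature.MathematicalPhysics.QuantumFieldTheory
open Literature.MathematicalPhysics.QuantumFieldTheory.Balaban1983to89
open Literature.MathematicalPhysics.QuantumFieldTheory.Balaban1983to89.Beta
open B12Sec2to5 (l1 l1_nonneg abs_coord_le_l1)
open ExpKernelCalculus (Site MKer Decays BiLoc Zl Zl_nonneg summable_exp_shift' tsum_exp_shift' l1_sub_symm)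
open OneStepResolventKernel (Fib decays_mono)
open OneStepKernelFamily (KInvStep decays_KInvStep)
open AffineAveraging (box toSite)
open AveragingHessianKernels (ell)
open AveragingHessianKernelsRooted (hessFFAt biLoc_hessFFAt)
open InterLevelTransport (SLam cwsum_apply)
open BalabanStepJetsSucc (E2 decays_E2 lamCoeffK abs_lamCoeffK_le mmRead_inr_left)
open Summit.QuantumFields.BalabanUV.Beta.GAN24.ValueHessianLinearGauge (tsum_E2_mul_grad_eq_zero_of_linGrowth)
open Summit.QuantumFields.BalabanUV.Beta.GAN24.ResolventLegCharges (summable_exp_coarse')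

namespace Summit.QuantumFields.BalabanUV.Beta.GAN24.LambdaSectorClassSlot

variable {d : ℕ} {Lc : ℕ} [NeZero Lc] {r : Fin (d + 1) → ℕ}

/-! ## §1 The value Hessian kills class slot data -/

omit [NeZero Lc] in
/-- [folklore] The lattice gradient of the class potential `φ(x) = c·x_ν + Φ(x_ν)` lives on the `ν`-bonds: `φ(y + e_l) − φ(y) = [l = ν]·(c + (Φ(y_ν+1) − Φ(y_ν)))`. -/
theorem classPot_grad (c : ℝ) (Φ : ℤ → ℝ) (ν : Fin (d + 1)) (y : Site (d + 1)) (l : Fin (d + 1)) :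
    (c * ((y + AffineAveraging.unitVec l) ν : ℝ) + Φ ((y + AffineAveraging.unitVec l) ν)) - (c * (y ν : ℝ) + Φ (y ν)) =
      if l = ν then c + (Φ (y ν + 1) - Φ (y ν)) else 0 := by
  by_cases hl : l = ν
  · subst hl
    simp only [Pi.add_apply, AffineAveraging.unitVec_apply, if_true]
    push_cast
    ring
  · have e : (y + AffineAveraging.unitVec l) ν = y ν := by
      simp only [Pi.add_apply, AffineAveraging.unitVec_apply, if_neg (Ne.symm hl), add_zero]
    rw [e, sub_self, if_neg hl]

omit [NeZero Lc] in
/-- [folklore] Linear growth of the class potential: `|c·y_ν + Φ(y_ν)| ≤ B + |c|·|y|₁`. -/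
theorem abs_classPot_le (c : ℝ) (Φ : ℤ → ℝ) {B : ℝ} (hΦ : ∀ s, |Φ s| ≤ B) (ν : Fin (d + 1)) (y : Site (d + 1)) :
    |c * (y ν : ℝ) + Φ (y ν)| ≤ B + |c| * l1 y := by
  refine (abs_add_le _ _).trans ?_
  rw [abs_mul, add_comm]
  exact add_le_add (hΦ _) (mul_le_mul_of_nonneg_left (abs_coord_le_l1 y ν) (abs_nonneg c))

/-- [folklore] **`E2_j` KILLS CLASS SLOT DATA** (column form): `Σ'_y E2 d Lc j (x,y)_{inl κ, inl ν}·(c + (Φ(y_ν+1) − Φ(y_ν))) = 0`. -/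
theorem tsum_E2_mul_classSlot_eq_zero (j : ℕ) (κ ν : Fin (d + 1)) (x : Site (d + 1)) (c : ℝ) (Φ : ℤ → ℝ) {B : ℝ} (hΦ : ∀ s, |Φ s| ≤ B) :
    ∑' y : Site (d + 1), E2 d Lc j x y (Sum.inl κ) (Sum.inl ν) * (c + (Φ (y ν + 1) - Φ (y ν))) = 0 := by
  have h := tsum_E2_mul_grad_eq_zero_of_linGrowth (Lc := Lc) j κ x (φ := fun y => c * (y ν : ℝ) + Φ (y ν)) (abs_classPot_le c Φ hΦ ν)
  simp only [classPot_grad, mul_ite, mul_zero, Finset.sum_ite_eq', Finset.mem_univ, if_true] at h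
  exact h

/-- [folklore] … for every first index `f` (the multiplier rows of `E2 = mmRead …` vanish). -/
theorem tsum_E2_mul_classSlot_eq_zero' (j : ℕ) (f : Fib d) (ν : Fin (d + 1)) (x : Site (d + 1)) (c : ℝ) (Φ : ℤ → ℝ) {B : ℝ} (hΦ : ∀ s, |Φ s| ≤ B) :
    ∑' y : Site (d + 1), E2 d Lc j x y f (Sum.inl ν) * (c + (Φ (y ν + 1) - Φ (y ν))) = 0 := by
  rcases f with κ | m
  · exact tsum_E2_mul_classSlot_eq_zero j κ ν x c Φ hΦ
  · simp only [E2, mmRead_inr_left, zero_mul, tsum_zero]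

/-! ## §2 The slot contraction of the conversion coefficients vanishes -/

/-- [folklore] The `(u, w)` family `s(u)·A (N•Y) w (inr μ) f·E w u f (inl ν)` (decaying `A`, `E`; bounded `s`) is absolutely summable. -/
theorem summable_pair_decays_classSlot {A E : MKer (d + 1) (Fib d)} {CA CE δ : ℝ} (hA : Decays A CA δ) (hE : Decays E CE δ) (hδ : 0 < δ)
    {s : Site (d + 1) → ℝ} {Bs : ℝ} (hs : ∀ u, |s u| ≤ Bs) (x : Site (d + 1)) (a b f : Fib d) :
    Summable fun uw : Site (d + 1) × Site (d + 1) => s uw.1 * (A x uw.2 a f * E uw.2 uw.1 f b) := by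
  have hCA : 0 ≤ CA := hA.nonneg (Sum.inl 0)
  have hCE : 0 ≤ CE := hE.nonneg (Sum.inl 0)
  have hBs : 0 ≤ Bs := (abs_nonneg _).trans (hs 0)
  have hMs : Summable fun uw : Site (d + 1) × Site (d + 1) => Bs * (CA * CE) * (Real.exp (-δ * l1 (x - uw.2)) * Real.exp (-δ * l1 (uw.2 - uw.1))) := by
    refine Summable.mul_left _ ?_
    have hs' : Summable fun wu : Site (d + 1) × Site (d + 1) => Real.exp (-δ * l1 (x - wu.1)) * Real.exp (-δ * l1 (wu.1 - wu.2)) := by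
      refine (summable_prod_of_nonneg (fun _ => mul_nonneg (Real.exp_pos _).le (Real.exp_pos _).le)).2 ⟨fun w => ?_, ?_⟩
      · have h := (summable_exp_shift' hδ w).mul_left (Real.exp (-δ * l1 (x - w)))
        exact h.congr fun u => by rw [l1_sub_symm u w]
      · have hb : ∀ w : Site (d + 1), ∑' u : Site (d + 1), Real.exp (-δ * l1 (x - w)) * Real.exp (-δ * l1 (w - u)) = Real.exp (-δ * l1 (x - w)) * Zl (d + 1) δ := by
          intro w
          rw [tsum_mul_left]
          congr 1
          rw [← tsum_exp_shift' (c := δ) w]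
          exact tsum_congr fun u => by rw [l1_sub_symm w u]
        simp only [hb]
        have h := (summable_exp_shift' hδ x).mul_right (Zl (d + 1) δ)
        exact h.congr fun w => by rw [l1_sub_symm w x]
    exact ((Equiv.prodComm (Site (d + 1)) (Site (d + 1))).summable_iff.2 hs').congr fun uw => by simp
  refine Summable.of_norm_bounded hMs (fun uw => ?_)
  rw [Real.norm_eq_abs, abs_mul, abs_mul]
  calc |s uw.1| * (|A x uw.2 a f| * |E uw.2 uw.1 f b|) ≤ Bs * ((CA * Real.exp (-δ * l1 (x - uw.2))) * (CE * Real.exp (-δ * l1 (uw.2 - uw.1)))) :=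
        mul_le_mul (hs _) (mul_le_mul (hA _ _ _ _) (hE _ _ _ _) (abs_nonneg _) (by positivity)) (by positivity) hBs
    _ = _ := by ring

/-- [folklore] **THE SLOT CONTRACTION OF THE Λ CONVERSION COEFFICIENTS WITH CLASS DATA VANISHES**:
`Σ'_u (c + (Φ(u_ν+1) − Φ(u_ν)))·lamCoeffK (KInvStep Lc j) (E2 d Lc j) Lc μ Y ν u = 0`. -/
theorem tsum_classSlot_lamCoeffK_eq_zero (j : ℕ) (μ ν : Fin (d + 1)) (Y : Site (d + 1)) (c : ℝ) (Φ : ℤ → ℝ) {B : ℝ} (hΦ : ∀ s, |Φ s| ≤ B) :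
    ∑' u : Site (d + 1), (c + (Φ (u ν + 1) - Φ (u ν))) * lamCoeffK (KInvStep (d := d) Lc j) (E2 d Lc j) Lc μ Y ν u = 0 := by
  classical
  -- common decay rate for `KInvStep j` and `E2 j`
  obtain ⟨δA, CA, hδA, hCA, hA⟩ := decays_KInvStep (Lc := Lc) (d := d) j
  obtain ⟨δE, CE, hδE, hCE, hE⟩ := decays_E2 (d := d) (Lc := Lc) j
  obtain ⟨n, hn0, hnA, hnE⟩ : ∃ n : ℝ, 0 < n ∧ n ≤ δA ∧ n ≤ δE := ⟨min δA δE, lt_min hδA hδE, min_le_left _ _, min_le_right _ _⟩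
  have hA' : Decays (KInvStep (d := d) Lc j) CA n := decays_mono hA hCA le_rfl hnA
  have hE' : Decays (E2 d Lc j) CE n := decays_mono hE hCE le_rfl hnE
  have hs : ∀ u : Site (d + 1), |c + (Φ (u ν + 1) - Φ (u ν))| ≤ |c| + (B + B) := fun u =>
    (abs_add_le _ _).trans (add_le_add le_rfl ((abs_sub _ _).trans (add_le_add (hΦ _) (hΦ _))))
  -- unfold the coefficient: `lamCoeffK A E N μ Y ν u = Σ'_w Σ_f A (N•Y) w (inr μ) f·E w u f (inl ν)`
  simp only [lamCoeffK, ExpKernelCalculus.comp]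
  -- per `f`, swap `(u, w)` and kill the inner `u`-sum
  have key : ∀ f : Fib d, ∑' u : Site (d + 1), (c + (Φ (u ν + 1) - Φ (u ν))) *
      ∑' w : Site (d + 1), KInvStep (d := d) Lc j ((Lc : ℤ) • Y) w (Sum.inr μ) f * E2 d Lc j w u f (Sum.inl ν) = 0 := by
    intro f
    have hP := summable_pair_decays_classSlot hA' hE' hn0 hs ((Lc : ℤ) • Y) (Sum.inr μ) (Sum.inl ν) f
    have hP' : Summable fun wu : Site (d + 1) × Site (d + 1) => (c + (Φ (wu.2 ν + 1) - Φ (wu.2 ν))) *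
        (KInvStep (d := d) Lc j ((Lc : ℤ) • Y) wu.1 (Sum.inr μ) f * E2 d Lc j wu.1 wu.2 f (Sum.inl ν)) :=
      ((Equiv.prodComm (Site (d + 1)) (Site (d + 1))).summable_iff.2 hP).congr fun wu => by simp
    calc ∑' u : Site (d + 1), (c + (Φ (u ν + 1) - Φ (u ν))) * ∑' w : Site (d + 1), KInvStep (d := d) Lc j ((Lc : ℤ) • Y) w (Sum.inr μ) f * E2 d Lc j w u f (Sum.inl ν)
        = ∑' u : Site (d + 1), ∑' w : Site (d + 1), (c + (Φ (u ν + 1) - Φ (u ν))) * (KInvStep (d := d) Lc j ((Lc : ℤ) • Y) w (Sum.inr μ) f * E2 d Lc j w u f (Sum.inl ν)) :=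
          tsum_congr fun u => (tsum_mul_left).symm
      _ = ∑' uw : Site (d + 1) × Site (d + 1), (c + (Φ (uw.1 ν + 1) - Φ (uw.1 ν))) * (KInvStep (d := d) Lc j ((Lc : ℤ) • Y) uw.2 (Sum.inr μ) f * E2 d Lc j uw.2 uw.1 f (Sum.inl ν)) :=
          (hP.tsum_prod).symm
      _ = ∑' wu : Site (d + 1) × Site (d + 1), (c + (Φ (wu.2 ν + 1) - Φ (wu.2 ν))) * (KInvStep (d := d) Lc j ((Lc : ℤ) • Y) wu.1 (Sum.inr μ) f * E2 d Lc j wu.1 wu.2 f (Sum.inl ν)) := by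
          rw [← (Equiv.prodComm (Site (d + 1)) (Site (d + 1))).tsum_eq (fun uw : Site (d + 1) × Site (d + 1) =>
            (c + (Φ (uw.1 ν + 1) - Φ (uw.1 ν))) * (KInvStep (d := d) Lc j ((Lc : ℤ) • Y) uw.2 (Sum.inr μ) f * E2 d Lc j uw.2 uw.1 f (Sum.inl ν)))]
          exact tsum_congr fun wu => by simp [Equiv.prodComm_apply]
      _ = ∑' w : Site (d + 1), ∑' u : Site (d + 1), (c + (Φ (u ν + 1) - Φ (u ν))) * (KInvStep (d := d) Lc j ((Lc : ℤ) • Y) w (Sum.inr μ) f * E2 d Lc j w u f (Sum.inl ν)) :=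
          hP'.tsum_prod
      _ = ∑' w : Site (d + 1), KInvStep (d := d) Lc j ((Lc : ℤ) • Y) w (Sum.inr μ) f * ∑' u : Site (d + 1), E2 d Lc j w u f (Sum.inl ν) * (c + (Φ (u ν + 1) - Φ (u ν))) := by
          refine tsum_congr fun w => ?_
          rw [← tsum_mul_left]
          exact tsum_congr fun u => by ring
      _ = 0 := by simp only [tsum_E2_mul_classSlot_eq_zero' j f ν _ c Φ hΦ, mul_zero, tsum_zero]
  -- the finite `f`-sum out of the `w`-sum and the `u`-sum
  have hsf : ∀ (u : Site (d + 1)) (f : Fib d), Summable fun w : Site (d + 1) =>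
      KInvStep (d := d) Lc j ((Lc : ℤ) • Y) w (Sum.inr μ) f * E2 d Lc j w u f (Sum.inl ν) := by
    intro u f
    have h1 : ∀ u', |(fun _ : Site (d + 1) => (1 : ℝ)) u'| ≤ 1 := fun _ => by simp
    have hP := summable_pair_decays_classSlot hA' hE' hn0 h1 ((Lc : ℤ) • Y) (Sum.inr μ) (Sum.inl ν) f
    simpa using hP.prod_factor u
  have e1 : ∀ u : Site (d + 1), ∑' w : Site (d + 1), ∑ f : Fib d, KInvStep (d := d) Lc j ((Lc : ℤ) • Y) w (Sum.inr μ) f * E2 d Lc j w u f (Sum.inl ν) =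
      ∑ f : Fib d, ∑' w : Site (d + 1), KInvStep (d := d) Lc j ((Lc : ℤ) • Y) w (Sum.inr μ) f * E2 d Lc j w u f (Sum.inl ν) := fun u =>
    Summable.tsum_finsetSum fun f _ => hsf u f
  simp only [e1, Finset.mul_sum]
  have hsu : ∀ f : Fib d, Summable fun u : Site (d + 1) => (c + (Φ (u ν + 1) - Φ (u ν))) *
      ∑' w : Site (d + 1), KInvStep (d := d) Lc j ((Lc : ℤ) • Y) w (Sum.inr μ) f * E2 d Lc j w u f (Sum.inl ν) := by
    intro f
    have hP := summable_pair_decays_classSlot hA' hE' hn0 hs ((Lc : ℤ) • Y) (Sum.inr μ) (Sum.inl ν) f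
    exact hP.prod.congr fun u => by dsimp only; exact tsum_mul_left
  rw [Summable.tsum_finsetSum fun f _ => hsu f]
  exact Finset.sum_eq_zero fun f _ => key f

/-! ## §3 The Λ sector carries no class-slot current -/

/-- [folklore] **THE Λ SECTOR OF `SrecAt (j+1)` CARRIES NO CLASS-SLOT CURRENT**: `Σ'_u (c + (Φ(u_ν+1) − Φ(u_ν)))·S^Λ_{j+1} ν u v q (inl κ′)(inl β) = 0` (every `v q κ′ β`). -/
theorem tsum_classSlot_lamSector_eq_zero (hr : r ∈ box (d + 1) Lc) (j : ℕ) (ν β κ' : Fin (d + 1)) (c : ℝ) (Φ : ℤ → ℝ) {B : ℝ} (hΦ : ∀ s, |Φ s| ≤ B)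
    (v q : Site (d + 1)) :
    ∑' u : Site (d + 1), (c + (Φ (u ν + 1) - Φ (u ν))) *
        SLam Lc (lamCoeffK (KInvStep (d := d) Lc (j + 1)) (E2 d Lc (j + 1)) Lc) (fun μ y => hessFFAt (toSite r) Lc μ y) ν u v q (Sum.inl κ') (Sum.inl β) = 0 := by
  classical
  have hLc : 1 ≤ Lc := Nat.one_le_iff_ne_zero.mpr (NeZero.ne Lc)
  -- constants
  obtain ⟨δA, CA, hδA, hCA, hA⟩ := decays_KInvStep (Lc := Lc) (d := d) (j + 1)
  obtain ⟨δE, CE, hδE, hCE, hE⟩ := decays_E2 (d := d) (Lc := Lc) (j + 1)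
  obtain ⟨n, hn0, hnA, hnE⟩ : ∃ n : ℝ, 0 < n ∧ n ≤ δA ∧ n ≤ δE := ⟨min δA δE, lt_min hδA hδE, min_le_left _ _, min_le_right _ _⟩
  have hA' : Decays (KInvStep (d := d) Lc (j + 1)) CA n := decays_mono hA hCA le_rfl hnA
  have hE' : Decays (E2 d Lc (j + 1)) CE n := decays_mono hE hCE le_rfl hnE
  have hc := abs_lamCoeffK_le hA' hE' hn0 Lc
  set CL : ℝ := (Fintype.card (Fib d) : ℝ) * (CA * CE) * Zl (d + 1) (n - n / 2) with hCL
  have hCL0 : 0 ≤ CL := by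
    have h := (abs_nonneg _).trans (hc 0 0 0 0)
    have hexp : 0 < Real.exp (-(n / 2) * l1 (((Lc : ℕ) : ℤ) • (0 : Site (d + 1)) - 0)) := Real.exp_pos _
    nlinarith
  have hn2 : (0 : ℝ) ≤ n / 2 := by positivity
  set CH : ℝ := 2 * (ell (d + 1) Lc : ℝ) ^ 2 * Real.exp (4 * ((d : ℝ) + 1) * Lc * (n / 2)) with hCH
  have hH : ∀ μ Y, BiLoc (hessFFAt (toSite r) Lc μ Y) ((Lc : ℤ) • Y) ((Lc : ℤ) • Y) CH (n / 2) := fun μ Y => biLoc_hessFFAt hLc μ Y hr hn2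
  have hCH0 : 0 ≤ CH := (hH 0 0).nonneg (Sum.inl 0)
  have hs : ∀ u : Site (d + 1), |c + (Φ (u ν + 1) - Φ (u ν))| ≤ |c| + (B + B) := fun u =>
    (abs_add_le _ _).trans (add_le_add le_rfl ((abs_sub _ _).trans (add_le_add (hΦ _) (hΦ _))))
  have hBs : 0 ≤ |c| + (B + B) := (abs_nonneg _).trans (hs 0)
  -- unfold the sector entry: `S^Λ ν u v q a b = −Σ_μ Σ'_Y lam(μ,Y,ν,u)·H(μ,Y) v q a b`
  have ept : ∀ u : Site (d + 1), SLam Lc (lamCoeffK (KInvStep (d := d) Lc (j + 1)) (E2 d Lc (j + 1)) Lc) (fun μ y => hessFFAt (toSite r) Lc μ y) ν u v q (Sum.inl κ') (Sum.inl β) =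
      -∑ μ : Fin (d + 1), ∑' Y : Site (d + 1), lamCoeffK (KInvStep (d := d) Lc (j + 1)) (E2 d Lc (j + 1)) Lc μ Y ν u * hessFFAt (toSite r) Lc μ Y v q (Sum.inl κ') (Sum.inl β) := by
    intro u
    simp only [SLam, cwsum_apply]
  -- the `(u, Y)` family per `μ` is absolutely summable
  have hpair : ∀ μ : Fin (d + 1), Summable fun uY : Site (d + 1) × Site (d + 1) => (c + (Φ (uY.1 ν + 1) - Φ (uY.1 ν))) *
      (lamCoeffK (KInvStep (d := d) Lc (j + 1)) (E2 d Lc (j + 1)) Lc μ uY.2 ν uY.1 * hessFFAt (toSite r) Lc μ uY.2 v q (Sum.inl κ') (Sum.inl β)) := by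
    intro μ
    have hMs : Summable fun uY : Site (d + 1) × Site (d + 1) => (|c| + (B + B)) * (CL * CH) *
        (Real.exp (-(n / 2) * l1 ((Lc : ℤ) • uY.2 - uY.1)) * Real.exp (-(n / 2) * l1 (v - (Lc : ℤ) • uY.2))) := by
      refine Summable.mul_left _ ?_
      have hs' : Summable fun Yu : Site (d + 1) × Site (d + 1) => Real.exp (-(n / 2) * l1 ((Lc : ℤ) • Yu.1 - Yu.2)) * Real.exp (-(n / 2) * l1 (v - (Lc : ℤ) • Yu.1)) := by
        refine (summable_prod_of_nonneg (fun _ => mul_nonneg (Real.exp_pos _).le (Real.exp_pos _).le)).2 ⟨fun Y => ?_, ?_⟩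
        · have h := (summable_exp_shift' (by positivity : 0 < n / 2) ((Lc : ℤ) • Y)).mul_right (Real.exp (-(n / 2) * l1 (v - (Lc : ℤ) • Y)))
          exact h.congr fun u => by rw [l1_sub_symm u ((Lc : ℤ) • Y)]
        · have hb : ∀ Y : Site (d + 1), ∑' u : Site (d + 1), Real.exp (-(n / 2) * l1 ((Lc : ℤ) • Y - u)) * Real.exp (-(n / 2) * l1 (v - (Lc : ℤ) • Y)) =
              Zl (d + 1) (n / 2) * Real.exp (-(n / 2) * l1 (v - (Lc : ℤ) • Y)) := by
            intro Y
            rw [tsum_mul_right]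
            congr 1
            rw [← tsum_exp_shift' (c := n / 2) ((Lc : ℤ) • Y)]
            exact tsum_congr fun u => by rw [l1_sub_symm ((Lc : ℤ) • Y) u]
          simp only [hb]
          exact (summable_exp_coarse' (d := d) hLc (by positivity : 0 < n / 2) v).mul_left _
      exact ((Equiv.prodComm (Site (d + 1)) (Site (d + 1))).summable_iff.2 hs').congr fun uY => by simp
    refine Summable.of_norm_bounded hMs (fun uY => ?_)
    rw [Real.norm_eq_abs, abs_mul, abs_mul]
    have h1 := hc μ uY.2 ν uY.1
    have h2 : |hessFFAt (toSite r) Lc μ uY.2 v q (Sum.inl κ') (Sum.inl β)| ≤ CH * Real.exp (-(n / 2) * l1 (v - (Lc : ℤ) • uY.2)) := by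
      refine (hH μ uY.2 v q _ _).trans (mul_le_mul_of_nonneg_left (Real.exp_le_exp.2 ?_) hCH0)
      nlinarith [l1_nonneg (v - (Lc : ℤ) • uY.2), l1_nonneg (q - (Lc : ℤ) • uY.2)]
    calc |c + (Φ (uY.1 ν + 1) - Φ (uY.1 ν))| * (|lamCoeffK (KInvStep (d := d) Lc (j + 1)) (E2 d Lc (j + 1)) Lc μ uY.2 ν uY.1| *
          |hessFFAt (toSite r) Lc μ uY.2 v q (Sum.inl κ') (Sum.inl β)|)
        ≤ (|c| + (B + B)) * ((CL * Real.exp (-(n / 2) * l1 ((Lc : ℤ) • uY.2 - uY.1))) * (CH * Real.exp (-(n / 2) * l1 (v - (Lc : ℤ) • uY.2)))) :=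
          mul_le_mul (hs _) (mul_le_mul h1 h2 (abs_nonneg _) (by positivity)) (by positivity) hBs
      _ = _ := by ring
  -- summand rewritten, finite `μ`-sum out, Fubini per `μ`, inner `u`-sum killed by §2
  have e : ∀ u : Site (d + 1), (c + (Φ (u ν + 1) - Φ (u ν))) *
      SLam Lc (lamCoeffK (KInvStep (d := d) Lc (j + 1)) (E2 d Lc (j + 1)) Lc) (fun μ y => hessFFAt (toSite r) Lc μ y) ν u v q (Sum.inl κ') (Sum.inl β) =
      -∑ μ : Fin (d + 1), (c + (Φ (u ν + 1) - Φ (u ν))) * ∑' Y : Site (d + 1),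
        lamCoeffK (KInvStep (d := d) Lc (j + 1)) (E2 d Lc (j + 1)) Lc μ Y ν u * hessFFAt (toSite r) Lc μ Y v q (Sum.inl κ') (Sum.inl β) := by
    intro u; rw [ept u, mul_neg, Finset.mul_sum]
  rw [tsum_congr e, tsum_neg, neg_eq_zero, Summable.tsum_finsetSum (fun μ _ => ((hpair μ).prod).congr fun u => by dsimp only; exact tsum_mul_left)]
  refine Finset.sum_eq_zero fun μ _ => ?_
  have hP := hpair μ
  have hP' : Summable fun Yu : Site (d + 1) × Site (d + 1) => (c + (Φ (Yu.2 ν + 1) - Φ (Yu.2 ν))) *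
      (lamCoeffK (KInvStep (d := d) Lc (j + 1)) (E2 d Lc (j + 1)) Lc μ Yu.1 ν Yu.2 * hessFFAt (toSite r) Lc μ Yu.1 v q (Sum.inl κ') (Sum.inl β)) :=
    ((Equiv.prodComm (Site (d + 1)) (Site (d + 1))).summable_iff.2 hP).congr fun Yu => by simp
  calc ∑' u : Site (d + 1), (c + (Φ (u ν + 1) - Φ (u ν))) * ∑' Y : Site (d + 1),
          lamCoeffK (KInvStep (d := d) Lc (j + 1)) (E2 d Lc (j + 1)) Lc μ Y ν u * hessFFAt (toSite r) Lc μ Y v q (Sum.inl κ') (Sum.inl β)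
      = ∑' u : Site (d + 1), ∑' Y : Site (d + 1), (c + (Φ (u ν + 1) - Φ (u ν))) *
          (lamCoeffK (KInvStep (d := d) Lc (j + 1)) (E2 d Lc (j + 1)) Lc μ Y ν u * hessFFAt (toSite r) Lc μ Y v q (Sum.inl κ') (Sum.inl β)) :=
        tsum_congr fun u => (tsum_mul_left).symm
    _ = ∑' uY : Site (d + 1) × Site (d + 1), (c + (Φ (uY.1 ν + 1) - Φ (uY.1 ν))) *
          (lamCoeffK (KInvStep (d := d) Lc (j + 1)) (E2 d Lc (j + 1)) Lc μ uY.2 ν uY.1 * hessFFAt (toSite r) Lc μ uY.2 v q (Sum.inl κ') (Sum.inl β)) := (hP.tsum_prod).symm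
    _ = ∑' Yu : Site (d + 1) × Site (d + 1), (c + (Φ (Yu.2 ν + 1) - Φ (Yu.2 ν))) *
          (lamCoeffK (KInvStep (d := d) Lc (j + 1)) (E2 d Lc (j + 1)) Lc μ Yu.1 ν Yu.2 * hessFFAt (toSite r) Lc μ Yu.1 v q (Sum.inl κ') (Sum.inl β)) := by
        rw [← (Equiv.prodComm (Site (d + 1)) (Site (d + 1))).tsum_eq (fun uY : Site (d + 1) × Site (d + 1) => (c + (Φ (uY.1 ν + 1) - Φ (uY.1 ν))) *
          (lamCoeffK (KInvStep (d := d) Lc (j + 1)) (E2 d Lc (j + 1)) Lc μ uY.2 ν uY.1 * hessFFAt (toSite r) Lc μ uY.2 v q (Sum.inl κ') (Sum.inl β)))]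
        exact tsum_congr fun Yu => by simp [Equiv.prodComm_apply]
    _ = ∑' Y : Site (d + 1), ∑' u : Site (d + 1), (c + (Φ (u ν + 1) - Φ (u ν))) *
          (lamCoeffK (KInvStep (d := d) Lc (j + 1)) (E2 d Lc (j + 1)) Lc μ Y ν u * hessFFAt (toSite r) Lc μ Y v q (Sum.inl κ') (Sum.inl β)) := hP'.tsum_prod
    _ = ∑' Y : Site (d + 1), (∑' u : Site (d + 1), (c + (Φ (u ν + 1) - Φ (u ν))) * lamCoeffK (KInvStep (d := d) Lc (j + 1)) (E2 d Lc (j + 1)) Lc μ Y ν u) *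
          hessFFAt (toSite r) Lc μ Y v q (Sum.inl κ') (Sum.inl β) := by
        refine tsum_congr fun Y => ?_
        rw [← tsum_mul_right]
        exact tsum_congr fun u => by ring
    _ = 0 := by simp only [tsum_classSlot_lamCoeffK_eq_zero (j + 1) μ ν _ c Φ hΦ, zero_mul, tsum_zero]

/-- [folklore] **COROLLARY — THE Λ HYPOTHESIS OF THE SECTOR SPLIT HOLDS FOR CLASS SLOT DATA** (any leg weight `h`, any `v`): the Λ-sector current is identically zero, so its first-leg
divergence vanishes. -/
theorem divFree_lamSector_current (hr : r ∈ box (d + 1) Lc) (j : ℕ) (ν β : Fin (d + 1)) (c : ℝ) (Φ : ℤ → ℝ) {B : ℝ} (hΦ : ∀ s, |Φ s| ≤ B)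
    (h : Site (d + 1) → ℝ) (v : Site (d + 1)) :
    ∑ κ' : Fin (d + 1),
      ((∑' q : Site (d + 1), h q * ∑' u : Site (d + 1), (c + (Φ (u ν + 1) - Φ (u ν))) *
          SLam Lc (lamCoeffK (KInvStep (d := d) Lc (j + 1)) (E2 d Lc (j + 1)) Lc) (fun μ y => hessFFAt (toSite r) Lc μ y) ν u v q (Sum.inl κ') (Sum.inl β))
        - ∑' q : Site (d + 1), h q * ∑' u : Site (d + 1), (c + (Φ (u ν + 1) - Φ (u ν))) *
          SLam Lc (lamCoeffK (KInvStep (d := d) Lc (j + 1)) (E2 d Lc (j + 1)) Lc) (fun μ y => hessFFAt (toSite r) Lc μ y) ν u (v - B6BondElimination.unitVec κ') q (Sum.inl κ') (Sum.inl β)) = 0 := by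
  simp only [tsum_classSlot_lamSector_eq_zero hr j ν β _ c Φ hΦ, mul_zero, tsum_zero, sub_self, Finset.sum_const_zero]

end Summit.QuantumFields.BalabanUV.Beta.GAN24.LambdaSectorClassSlot
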